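import Literature.Geometry.Kaehler.ChainSheetFormula
import HarnessLib

/-!
# The projection formula for a sheeted piece of a holomorphic chain

Let `T` be a holomorphic `p`-chain (`p = q + 1`) on an open `Ω ⊆ V`, `ℓ : V → P` a continuous
complex-linear map to a `p`-dimensional complex inner product space, `U ⊆ V` and `G ⊆ P` open.
We say that **`T` is `k`-sheeted over `G` in `U`** (`HolomorphicChain.IsSheetedOver`) if every
point of `G` has a neighbourhood `W ⊆ G` over which `reg|T| ∩ U` is the disjoint union of the
images of `k` holomorphic sections `s₁, …, s_k : W → U` of `ℓ`, each parametrising a relatively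
open piece of the carrier — the structure of an analytic cover off its critical values
[Chirka1989, §3.7 Thm.], for the chain `[A]` of an analytic set (`ChainProjectionCover.lean`).

Summing the sheet formula (`ChainSheetFormula.lean`, `lintegral_image_section_eq`) over the
sheets and over a countable measurable partition of the base subordinate to such neighbourhoods
gives **the projection formula** (`IsSheetedOver.lintegral_inter_preimage_eq`): for every
continuous field `Φ` of real `2p`-covectors on `P`, unitary basis `e` of `P` and measurable
`S ⊆ G`,

`∫_{reg|T| ∩ U ∩ ℓ⁻¹ S} Φ(ℓ z)(ℓ ∘ ξ_T(z)) d𝓗^{2p}(z) = k ∫_S Φ(w)(e₀, i e₀, …) d𝓗^{2p}(w)`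

(with `ENNReal.ofReal` integrands), and the same over a measurable `B ⊇ G` when `B ∖ G` and the
part of the carrier over it are null (`…_of_null`) — "the projection `A ∩ U → U'` is a `k`-sheeted
analytic cover, hence `∫_{A ∩ U} π^*φ = k ∫_{U'} φ`" [Chirka1989, §15.1, proof of Prop. 2 (via
§11.2); Demailly, Ch. III (7.4)].

## References

* E. M. Chirka, *Complex Analytic Sets*, Kluwer 1989, §3.7, §11.1–11.2, §15.1 [Chirka1989].
* H. Federer, *Geometric Measure Theory*, 1969, 4.1.28 [Federer1969].
-/

noncomputable section

open scoped Manifold Topology ENNReal NNReal InnerProductSpace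
open Set Filter MeasureTheory Metric Module Function

universe u

namespace Literature.Geometry.Kaehler

open Literature.Geometry.GeometricMeasureTheory

variable {V : Type u} [NormedAddCommGroup V] [InnerProductSpace ℂ V] [FiniteDimensional ℂ V]
  [MeasurableSpace V] [BorelSpace V] {Ω : TopologicalSpace.Opens V} {q : ℕ}
  {P : Type*} [NormedAddCommGroup P] [InnerProductSpace ℂ P] [FiniteDimensional ℂ P]
  [MeasurableSpace P] [BorelSpace P]

namespace HolomorphicChain

/-- **`T` is `k`-sheeted over `G` in `U` along `ℓ`**: `G` is open and each of its points has an
open neighbourhood `W ⊆ G` with `k` holomorphic sections `s j : W → V` of `ℓ` whose images are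
contained in `reg|T| ∩ U`, are relatively open in the carrier, pairwise disjoint, and exhaust
`reg|T| ∩ U` over `W` — an unramified `k`-sheeted analytic cover `ℓ : reg|T| ∩ U ∩ ℓ⁻¹ G → G`.
[cite: Chirka1989, §3.7 Thm.] -/
structure IsSheetedOver (T : HolomorphicChain 𝓘(ℂ, V) Ω (q + 1)) (ℓ : V →L[ℂ] P) (U : Set V)
    (G : Set P) (k : ℕ) : Prop where
  isOpen_inner : IsOpen U
  isOpen_base : IsOpen G
  sheets : ∀ w₀ ∈ G, ∃ W : Set P, IsOpen W ∧ w₀ ∈ W ∧ W ⊆ G ∧ ∃ s : Fin k → P → V,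
    (∀ j, DifferentiableOn ℂ (s j) W) ∧ (∀ j, ∀ w ∈ W, ℓ (s j w) = w) ∧
    (∀ j, s j '' W ⊆ T.carrier ∩ U) ∧
    (∀ j, ∀ t ∈ W, ∃ N ∈ 𝓝 (s j t), T.carrier ∩ N ⊆ s j '' W) ∧
    (∀ i j, i ≠ j → ∀ w ∈ W, s i w ≠ s j w) ∧
    T.carrier ∩ U ∩ ℓ ⁻¹' W ⊆ ⋃ j, s j '' W

/-- **The projection formula over one sheet neighbourhood**: if `reg|T| ∩ U` over the open `W` is
the disjoint union of the images of `k` sections as in `IsSheetedOver`, then for measurable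
`S ⊆ W`, `∫_{reg|T| ∩ U ∩ ℓ⁻¹ S} Φ(ℓ z)(ℓ ∘ ξ_T) = k ∫_S Φ(w)(e₀, i e₀, …)`. [cite: Chirka1989, §15.1] -/
theorem lintegral_inter_preimage_eq_of_sheets (T : HolomorphicChain 𝓘(ℂ, V) Ω (q + 1))
    (hP : finrank ℂ P = q + 1) (ℓ : V →L[ℂ] P) {U : Set V} {W : Set P} (hW : IsOpen W) {k : ℕ}
    {s : Fin k → P → V} (hs : ∀ j, DifferentiableOn ℂ (s j) W) (hℓs : ∀ j, ∀ w ∈ W, ℓ (s j w) = w)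
    (hsW : ∀ j, s j '' W ⊆ T.carrier ∩ U)
    (hopen : ∀ j, ∀ t ∈ W, ∃ N ∈ 𝓝 (s j t), T.carrier ∩ N ⊆ s j '' W)
    (hdisj : ∀ i j, i ≠ j → ∀ w ∈ W, s i w ≠ s j w) (hcov : T.carrier ∩ U ∩ ℓ ⁻¹' W ⊆ ⋃ j, s j '' W)
    {Φ : P → P [⋀^Fin (2 * (q + 1))]→L[ℝ] ℝ} (hΦ : Continuous Φ)
    (e : OrthonormalBasis (Fin (q + 1)) ℂ P) {S : Set P} (hSm : MeasurableSet S) (hSW : S ⊆ W) :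
    ∫⁻ z in T.carrier ∩ U ∩ ℓ ⁻¹' S, ENNReal.ofReal (Φ (ℓ z) (fun i => ℓ (T.orientationFrame z i)))
        ∂(μHE[2 * (q + 1)] : Measure V) =
      k * ∫⁻ w in S, ENNReal.ofReal (Φ w (complexFrame e)) ∂(μHE[2 * (q + 1)] : Measure P) := by
  -- the region is the disjoint union of the sheet images of `S`
  have hreg : T.carrier ∩ U ∩ ℓ ⁻¹' S = ⋃ j, s j '' S := by
    ext z
    simp only [mem_inter_iff, mem_preimage, mem_iUnion, mem_image]
    constructor
    · rintro ⟨⟨hzc, hzU⟩, hzS⟩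
      obtain ⟨j, w, hw, rfl⟩ := mem_iUnion.1 (hcov ⟨⟨hzc, hzU⟩, hSW hzS⟩)
      refine ⟨j, w, ?_, rfl⟩
      have : ℓ (s j w) ∈ S := hzS
      rwa [hℓs j w hw] at this
    · rintro ⟨j, w, hw, rfl⟩
      refine ⟨hsW j ⟨w, hSW hw, rfl⟩, ?_⟩
      rw [hℓs j w (hSW hw)]
      exact hw
  have hmeas : ∀ j, MeasurableSet (s j '' S) := fun j =>
    hSm.image_of_continuousOn_injOn ((hs j).continuousOn.mono hSW)
      ((LeftInvOn.injOn (hℓs j)).mono hSW)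
  have hdisj' : Pairwise (Disjoint on fun j => s j '' S) := by
    intro i j hij
    rw [Function.onFun, Set.disjoint_left]
    rintro _ ⟨w, hw, rfl⟩ ⟨w', hw', heq⟩
    have h1 : w' = w := by
      have := congrArg ℓ heq
      rwa [hℓs j w' (hSW hw'), hℓs i w (hSW hw)] at this
    subst h1
    exact hdisj i j hij w' (hSW hw) heq.symm
  rw [hreg, lintegral_iUnion hmeas hdisj']
  simp_rw [T.lintegral_image_section_eq hP ℓ hW (hs _) (hℓs _) ((hsW _).trans inter_subset_left)
    (hopen _) hΦ e hSm hSW]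
  rw [tsum_fintype, Finset.sum_const, Finset.card_univ, Fintype.card_fin, nsmul_eq_mul]

namespace IsSheetedOver

variable {T : HolomorphicChain 𝓘(ℂ, V) Ω (q + 1)} {ℓ : V →L[ℂ] P} {U : Set V} {G : Set P} {k : ℕ}

/-- **The projection formula for a sheeted piece of a holomorphic chain**:
`∫_{reg|T| ∩ U ∩ ℓ⁻¹ S} Φ(ℓ z)(ℓ ∘ ξ_T(z)) d𝓗^{2p} = k ∫_S Φ(w)(e₀, i e₀, …) d𝓗^{2p}` for every
measurable `S ⊆ G` — summing the sheet formula over a countable measurable partition of `S`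
subordinate to the sheet neighbourhoods. [cite: Chirka1989, §15.1 (proof of Prop. 2); Federer1969, 4.1.28] -/
theorem lintegral_inter_preimage_eq (h : T.IsSheetedOver ℓ U G k) (hP : finrank ℂ P = q + 1)
    {Φ : P → P [⋀^Fin (2 * (q + 1))]→L[ℝ] ℝ} (hΦ : Continuous Φ)
    (e : OrthonormalBasis (Fin (q + 1)) ℂ P) {S : Set P} (hSm : MeasurableSet S) (hSG : S ⊆ G) :
    ∫⁻ z in T.carrier ∩ U ∩ ℓ ⁻¹' S, ENNReal.ofReal (Φ (ℓ z) (fun i => ℓ (T.orientationFrame z i)))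
        ∂(μHE[2 * (q + 1)] : Measure V) =
      k * ∫⁻ w in S, ENNReal.ofReal (Φ w (complexFrame e)) ∂(μHE[2 * (q + 1)] : Measure P) := by
  classical
  choose! W hWo hwW hWG hsh using h.sheets
  have hloc : ∀ w₀ ∈ G, ∀ S' : Set P, MeasurableSet S' → S' ⊆ W w₀ →
      ∫⁻ z in T.carrier ∩ U ∩ ℓ ⁻¹' S', ENNReal.ofReal (Φ (ℓ z) (fun i => ℓ (T.orientationFrame z i)))
          ∂(μHE[2 * (q + 1)] : Measure V) =
        k * ∫⁻ w in S', ENNReal.ofReal (Φ w (complexFrame e)) ∂(μHE[2 * (q + 1)] : Measure P) := by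
    intro w₀ hw₀ S' hS'm hS'W
    obtain ⟨s, hs, hℓs, hsW, hopen, hdisj, hcov⟩ := hsh w₀ hw₀
    exact lintegral_inter_preimage_eq_of_sheets T hP ℓ (hWo w₀ hw₀) hs hℓs hsW hopen hdisj hcov hΦ e
      hS'm hS'W
  rcases G.eq_empty_or_nonempty with hG | ⟨g₀, hg₀⟩
  · have hS : S = ∅ := subset_eq_empty hSG hG
    simp [hS]
  -- a countable subcover of the sheet neighbourhoods
  obtain ⟨C, hCc, hCU⟩ := TopologicalSpace.isOpen_iUnion_countable (fun w : G => W w) fun w => hWo w w.2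
  have hcovG : G ⊆ ⋃ w ∈ C, W (w : P) := by
    rw [hCU]
    exact fun x hx => mem_iUnion.2 ⟨⟨x, hx⟩, hwW x hx⟩
  have hCne : C.Nonempty := by
    by_contra hC
    rw [not_nonempty_iff_eq_empty] at hC
    have := hcovG hg₀
    simp [hC] at this
  obtain ⟨wseq, hwseq⟩ := hCc.exists_eq_range hCne
  set Wn : ℕ → Set P := fun n => W (wseq n : P) with hWn
  have hScov : S ⊆ ⋃ n, Wn n := by
    intro x hx
    obtain ⟨w, hwC, hxw⟩ := mem_iUnion₂.1 (hcovG (hSG hx))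
    obtain ⟨n, rfl⟩ : ∃ n, wseq n = w := by
      have : w ∈ range wseq := hwseq ▸ hwC
      exact this
    exact mem_iUnion.2 ⟨n, hxw⟩
  -- a measurable partition of `S` subordinate to the cover
  set D : ℕ → Set P := disjointed fun n => S ∩ Wn n with hD
  have hDm : ∀ n, MeasurableSet (D n) :=
    MeasurableSet.disjointed fun n => hSm.inter (hWo _ (wseq n).2).measurableSet
  have hDdisj : Pairwise (Disjoint on D) := disjoint_disjointed _
  have hDsub : ∀ n, D n ⊆ S ∩ Wn n := fun n => disjointed_subset _ n
  have hDU : (⋃ n, D n) = S := by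
    rw [hD, iUnion_disjointed, ← inter_iUnion, inter_eq_left.2 hScov]
  have hregion : T.carrier ∩ U ∩ ℓ ⁻¹' S = ⋃ n, T.carrier ∩ U ∩ ℓ ⁻¹' D n := by
    rw [← inter_iUnion, ← preimage_iUnion, hDU]
  have hRm : ∀ n, MeasurableSet (T.carrier ∩ U ∩ ℓ ⁻¹' D n) := fun n =>
    (T.measurableSet_carrier.inter h.isOpen_inner.measurableSet).inter
      ((hDm n).preimage ℓ.continuous.measurable)
  have hRdisj : Pairwise (Disjoint on fun n => T.carrier ∩ U ∩ ℓ ⁻¹' D n) := fun i j hij =>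
    ((hDdisj hij).preimage ℓ).mono inter_subset_right inter_subset_right
  rw [hregion, lintegral_iUnion hRm hRdisj, ← hDU, lintegral_iUnion hDm hDdisj, ← ENNReal.tsum_mul_left]
  exact tsum_congr fun n => hloc _ (wseq n).2 (D n) (hDm n) ((hDsub n).trans inter_subset_right)

/-- **The projection formula over a base set differing from `G` by null sets**: if `B ⊇ G` is
measurable, `B ∖ G` is `𝓗^{2p}`-null in `P` and the part of `reg|T| ∩ U` over `B ∖ G` is
`𝓗^{2p}`-null in `V` (e.g. `B` a ball and `B ∖ G` the critical values of the cover), then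
`∫_{reg|T| ∩ U ∩ ℓ⁻¹ B} Φ(ℓ z)(ℓ ∘ ξ_T) = k ∫_B Φ(w)(e₀, i e₀, …)`. [cite: Chirka1989, §15.1] -/
theorem lintegral_inter_preimage_eq_of_null (h : T.IsSheetedOver ℓ U G k) (hP : finrank ℂ P = q + 1)
    {Φ : P → P [⋀^Fin (2 * (q + 1))]→L[ℝ] ℝ} (hΦ : Continuous Φ)
    (e : OrthonormalBasis (Fin (q + 1)) ℂ P) {B : Set P} (hGB : G ⊆ B)
    (hnullP : (μHE[2 * (q + 1)] : Measure P) (B \ G) = 0)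
    (hnullV : (μHE[2 * (q + 1)] : Measure V) (T.carrier ∩ U ∩ ℓ ⁻¹' (B \ G)) = 0) :
    ∫⁻ z in T.carrier ∩ U ∩ ℓ ⁻¹' B, ENNReal.ofReal (Φ (ℓ z) (fun i => ℓ (T.orientationFrame z i)))
        ∂(μHE[2 * (q + 1)] : Measure V) =
      k * ∫⁻ w in B, ENNReal.ofReal (Φ w (complexFrame e)) ∂(μHE[2 * (q + 1)] : Measure P) := by
  have hsplitV : T.carrier ∩ U ∩ ℓ ⁻¹' B =
      (T.carrier ∩ U ∩ ℓ ⁻¹' G) ∪ (T.carrier ∩ U ∩ ℓ ⁻¹' (B \ G)) := by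
    rw [← inter_union_distrib_left, ← preimage_union, union_sdiff_cancel hGB]
  have hsplitP : G ∪ (B \ G) = B := union_sdiff_cancel hGB
  rw [hsplitV, setLIntegral_congr (union_ae_eq_left_of_ae_eq_empty (ae_eq_empty.2 hnullV)),
    h.lintegral_inter_preimage_eq hP hΦ e h.isOpen_base.measurableSet Subset.rfl, ← hsplitP,
    setLIntegral_congr (union_ae_eq_left_of_ae_eq_empty (ae_eq_empty.2 hnullP))]

end IsSheetedOver

end HolomorphicChain

end Literature.Geometry.Kaehler

end
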